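import Summits.BirchSwinnertonDyer.BirchSwinnertonDyer.Theorems.ErratumRoadFiveNonSurjCornerTwinMuAnUnitDerivative
import Literature.NumberTheory.EllipticCurves.CanonicalPAdicHeightRestrictionProofs
import Literature.NumberTheory.EllipticCurves.CanonicalPAdicHeightIntegralityProofs
import Literature.NumberTheory.EllipticCurves.PadicSigmaLogFirstOrderProofs
import HarnessLib

/-!
# Route `ErratumRoadFive` (K2), crux `NonSurjCorner` (item stmt-BirchSwinnertonDyer-19065), gen-3 child 23047
# `NonSurjCornerTwinMuAnDeep`: THE SPLIT FLOOR — at a SPLIT multiplicative `p` whose Tate parameter is a `p`-th power,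
# `[T⁰](ϖ·L_p) = 0` AND `[T¹](ϖ·L_p)` IS NOT A UNIT, so every certificate of 23047's clause sits at an index `n ≥ 2`
# (cell `bsd-stepL`, WIDTH-LEVER lane B `bsd-stepL-corner5-p2` g16; `--supports stmt-BirchSwinnertonDyer-23047 --as helper`)

WHY. Item 23047 asks, at every Friedberg–Hoffstein twin `Wd = Cd • E^{(d_K)}` of a DEEP corner pair `(E, p)`, for SOME `p`-adic unit
coefficient of `ϖ·L_p(Wd, T)`. Lane B's hunt beyond the census box (g15) produced the FIRST corner pair that is SPLIT at `p`
(`J9t-231o115d94`, `p = 5`, `a₅ = +1`, kernel instance `CornerFive.Tm231o115d94`, p732472); each of its Heegner twins is again split at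
`5` (`5` splits in `K`). At a split `p` the Mazur–Tate–Teitelbaum function has the trivial zero `[T⁰] = 0`
(`IsSplitMultPAdicLFunctionOf.constantCoeff_eq_zero`), and by GREENBERG–STEVENS (tree fact `greenberg_stevens`, by name)
`[T¹]·log_p γ = 𝓛_p(E)·[0]⁺_f` with `𝓛_p(E) = log_p q_E ∕ ord_p q_E`. THE POINT OF THIS FILE: on the corner the image of `ρ̄_{E,p}`
is irreducible and NOT surjective, hence of order prime to `p` (Serre 1972, Prop. 15: a subgroup of `GL₂(𝔽_p)` of order divisible
by `p` is Borel or contains `SL₂(𝔽_p)`), so the decomposition group at `p` acts semisimply on `E[p]`; for a Tate curve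
`ρ̄|_{G_{ℚ_p}} = (ω, κ_q; 0, 1)` with `κ_q` the Kummer class of `q_E` (Serre 1972, §1.12 / Prop. 13), so `κ_q = 0`:
**`q_E ∈ (ℚ_p^×)^p`** — in particular `p ∣ ord_p q_E = ord_p Δ_min` (the corner's defining divisibility, recovered) AND the unit
part `u = q_E p^{−ord}` is a `p`-th power, i.e. `‖log_p q_E‖ ≤ p^{−2}`. Consequently
`‖[T¹](ϖ·L_p)‖ = ‖log_p q_E‖·‖ϖ[0]⁺_f ∕ ord_p q_E‖ ∕ ‖log_p γ‖ ≤ p^{−2}·1·p = p^{−1}` as soon as `ϖ[0]⁺_f ∕ ord_p q_E` is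
`p`-integral — which is the corner's shape: `ϖ[0]⁺_f = L(Wd,1)∕Ω = #Ш_an·∏c∕#tors²` with `c_p = ord_p Δ_min = ord_p q_E` at a split `p`.
So at a split corner twin NO certificate exists below `T²`: the unit-value road (`[T⁰]`) and the `[T¹]` road are both closed
STRUCTURALLY (by the image), every split twin needs a level-`p²` table (x11a `MuTable.checkRiemannSum`, `lam ≥ 1` on a split
table, here sharpened to `lam ≥ 2`), and `v_p[T¹] = 1 + v_p(#Ш_an·∏_{ℓ≠p} c_ℓ)` exactly when `v_p(log_p u) = 2`. Numerics of record
(kit j334371 ∕ j334380, lane B g16): `v₅(log₅ u) = 2` at `J9t-231o115d94` (`u ≡ 7 (mod 125)`) and at x11a's split corner members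
`6480d1`, `25920q1`, `51840l1` (all `λ = 3`), against `v₅ = 1` at 128 of 147 random split irreducible curves with `5 ∥ N`, `5 ∣ ord₅Δ`;
the v2 engine's level-25 table of `6480d1` has `RS = [0, 5, 30, 24, 6]` (`v₅[T¹] = 1` as predicted: `x(0) = 5`).

RELATION TO g6. Lane B g6's `…TwinMuAnUnitDerivative.lean` (`X11b.MuAnUnit.*`) formalised the POSITIVE road at a split `p`:
`‖[T¹](ϖ·L)‖ = p·‖ϖ·𝓛_p·[0]⁺_f‖` (`MuAnUnit.norm_coeff_one_C_mul_of_one`) and the certificate `n = 1` ON THE UNIT-DERIVATIVE LOCUS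
«`‖ϖ·𝓛_p(Wd)·[0]⁺_f‖ = p⁻¹`». THIS FILE is its negative complement: with `q_E` a `p`-th power and `ϖ[0]⁺_f ∕ ord_p q_E` integral,
`‖ϖ·𝓛_p·[0]⁺_f‖ ≤ p⁻²` — the unit-derivative locus is EMPTY on the corner (`SplitFloor.norm_LInvariant_term_le`,
`SplitFloor.not_unitDerivativeLocus`), whence the floor.

WHAT IS PROVED (theorems only; the two structural inputs are DISPLAYED hypotheses, not facts minted here):
* §1 `SplitFloor.norm_padicLog_le_of_pow` (`q = r^p ⟹ ‖log_p q‖ ≤ p⁻²`), `SplitFloor.norm_LInvariant_term_le` (`‖ϖ·𝓛_p·[0]⁺_f‖ ≤ p⁻²`),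
  `SplitFloor.not_unitDerivativeLocus` (g6's hypothesis fails), `SplitFloor.norm_coeff_one_C_mul_le` — `E/ℚ`, odd `p`, Tate datum `Dq` with
  `q` a `p`-th power in `ℚ_p` (`hq`), newform `f`, `L` with `IsMultPAdicLFunctionOf f p 1 L`, any `ϖ : ℚ` with `‖ϖ·[0]⁺_f‖ ≤ ‖ord_p q‖`
  (`hint`): granted `greenberg_stevens E p`, `‖[T¹](ϖ·L)‖ ≤ p⁻¹`.
* §2 `SplitFloor.two_le_of_norm_coeff_eq_one` — same data: every index `n` with `‖[Tⁿ](ϖ·L)‖ = 1` has `2 ≤ n`; and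
  `SplitFloor.two_le_of_norm_coeff_eq_one_of_allowableRoot` — the same in the binder shape of 23047's clause
  (`a` the allowable root, `split → a = 1`, `IsMultPAdicLFunctionOf f p a L`).
HONEST FRAMING: CONDITIONAL on `greenberg_stevens` BY NAME (print for `p ≥ 5`: Greenberg–Stevens 1993; odd `p`: Kobayashi 2006) and on the
two displayed hypotheses `hq` (the `p`-th-power shape of `q_E`, whose derivation from «irreducible, not surjective» — Serre's Prop. 15 and
the Tate-curve Kummer class — is NOT formalised here) and `hint`; nothing is asserted about any curve; no certificate is produced (this is a
FLOOR, a negative structural lemma about where certificates can sit); items 19065 ∕ 23047 stay OPEN; closes: none (T7); BSD is proved for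
no curve or class.
References: [GreenbergStevens1993] Introduction Thm. (0.3) = Thm. 7.1; [Kobayashi2006DocMath] Cor. 4.2 (p. 575); [MazurTateTeitelbaum1986Invent]
§I.15 Prop. case I (trivial zero), §II.1 (𝓛_p); [Serre1972] Prop. 15 (p. 280) and §1.12 (courbes de Tate); [Iwasawa1972PadicL] §4.4 (log_p);
tree: g6 `…TwinMuAnUnitDerivative.lean` (`MuAnUnit.norm_coeff_one_C_mul_of_one`, `coeff_zero_C_mul_of_one`), `PAdicBSD.lean` (`greenberg_stevens`),
`PAdicHeights.lean` (`TateParameterData`, `LInvariant`, `padicLog`), `CanonicalPAdicHeight{Restriction,Integrality}Proofs.lean` (`padicLog_pow`,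
`norm_padicLog_le_inv`), x11a `X11aPrintCertificates/ClaimMuTableRiemannSum.lean` (`checkRiemannSum`, `lam ≥ 1` at split), lane B
`…TwinMuAnDeepOfTables.lean` (the table door).
-/

set_option autoImplicit false
set_option linter.dupNamespace false -- `Summit.BirchSwinnertonDyer.BirchSwinnertonDyer` (summit = problem), tree-wide

noncomputable section

open scoped Classical MatrixGroups ModularForm

namespace Summit.BirchSwinnertonDyer.BirchSwinnertonDyer.Theorems

open CongruenceSubgroup WeierstrassCurve Literature.NumberTheory.EllipticCurves
  Literature.NumberTheory.EllipticCurves.ModularForms Summit.BirchSwinnertonDyer.Rank1Residual.X11b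

namespace SplitFloor

variable {W : WeierstrassCurve ℚ} [W.IsElliptic] {p : ℕ} [Fact p.Prime]

/-- `‖log_p q‖ ≤ p⁻²` when `q` is a `p`-th power in `ℚ_p^×`, `p` odd: `log_p q = p·log_p r` and `‖log_p r‖ ≤ p⁻¹` (the Iwasawa
logarithm maps `ℚ_p^×` into `pℤ_p`). This is the valuation of the numerator of `𝓛_p(E) = log_p q_E ∕ ord_p q_E` at a split corner member,
where `q_E` is a `p`-th power because the image of `ρ̄_{E,p}` has order prime to `p`. [cite: Iwasawa1972PadicL, §4.4]
[cite: Serre1972, Prop. 15 (p. 280) and §1.12 (the Kummer class of q for a Tate curve)] -/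
theorem norm_padicLog_le_of_pow (hp2 : p ≠ 2) {q r : ℚ_[p]} (hq0 : q ≠ 0) (hr : r ^ p = q) :
    ‖padicLog p q‖ ≤ (p : ℝ)⁻¹ * (p : ℝ)⁻¹ := by
  have hr0 : r ≠ 0 := by
    rintro rfl
    exact hq0 (by rw [← hr, zero_pow (Fact.out : p.Prime).ne_zero])
  rw [← hr, padicLog_pow p hr0 p, norm_mul]
  have hnp : ‖(p : ℚ_[p])‖ = (p : ℝ)⁻¹ := Padic.norm_p
  rw [hnp]
  exact mul_le_mul_of_nonneg_left (norm_padicLog_le_inv hp2 _) (by positivity)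

/-- **The `𝓛`-invariant term is too small on the corner**: with the Tate parameter a `p`-th power (`hq`) and `ϖ[0]⁺_f ∕ ord_p q`
`p`-integral (`hint`), `‖ϖ·𝓛_p(E)·[0]⁺_f‖ ≤ p⁻²` (`𝓛_p = log_p q ∕ ord_p q`, `‖log_p q‖ ≤ p⁻²`). Unconditional (no named fact).
[cite: MazurTateTeitelbaum1986Invent, §II.1 (𝓛_p = log_p q ∕ ord_p q)] [cite: Serre1972, Prop. 15 (p. 280)] -/
theorem norm_LInvariant_term_le (hp2 : p ≠ 2) (Dq : TateParameterData W p) (hq : ∃ r : ℚ_[p], r ^ p = Dq.q)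
    {N : ℕ} (f : CuspForm (Gamma0 N) 2) (ϖ : ℚ)
    (hint : ‖((ϖ * ratPlusSymbol f 0 : ℚ) : ℚ_[p])‖ ≤ ‖((Dq.q.valuation : ℤ) : ℚ_[p])‖) :
    ‖((ϖ : ℚ) : ℚ_[p]) * LInvariant Dq * (ratPlusSymbol f 0 : ℚ_[p])‖ ≤ (p : ℝ)⁻¹ * (p : ℝ)⁻¹ := by
  obtain ⟨r, hr⟩ := hq
  have hlogq : ‖padicLog p Dq.q‖ ≤ (p : ℝ)⁻¹ * (p : ℝ)⁻¹ := norm_padicLog_le_of_pow hp2 Dq.q_ne_zero hr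
  have hv0 : ((Dq.q.valuation : ℤ) : ℚ_[p]) ≠ 0 := by
    exact_mod_cast Dq.valuation_q_pos.ne'
  -- `ϖ·𝓛·[0]⁺ = log_p q · (ϖ[0]⁺ / ord_p q)`
  have hkey : ((ϖ : ℚ) : ℚ_[p]) * LInvariant Dq * (ratPlusSymbol f 0 : ℚ_[p]) =
      padicLog p Dq.q * ((((ϖ * ratPlusSymbol f 0 : ℚ) : ℚ_[p])) / ((Dq.q.valuation : ℤ) : ℚ_[p])) := by
    rw [LInvariant]
    push_cast
    field_simp
  have hrat : ‖((ϖ * ratPlusSymbol f 0 : ℚ) : ℚ_[p])‖ / ‖((Dq.q.valuation : ℤ) : ℚ_[p])‖ ≤ 1 := by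
    rw [div_le_one (norm_pos_iff.mpr hv0)]
    exact hint
  rw [hkey, norm_mul, norm_div]
  calc ‖padicLog p Dq.q‖ * (‖((ϖ * ratPlusSymbol f 0 : ℚ) : ℚ_[p])‖ / ‖((Dq.q.valuation : ℤ) : ℚ_[p])‖)
      ≤ (p : ℝ)⁻¹ * (p : ℝ)⁻¹ * 1 :=
        mul_le_mul hlogq hrat (div_nonneg (norm_nonneg _) (norm_nonneg _)) (by positivity)
    _ = (p : ℝ)⁻¹ * (p : ℝ)⁻¹ := mul_one _

/-- **g6's unit-derivative locus is EMPTY when `q_E` is a `p`-th power**: the hypothesis «`‖ϖ·𝓛_p(Wd)·[0]⁺_f‖ = p⁻¹`» of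
`MuAnUnit.exists_norm_coeff_eq_one_of_one` ∕ `Theorems.nonSurjCornerTwinMuAn_split_of_unit_derivative` fails under `hq` and `hint`
(`p⁻² < p⁻¹`). On the corner `hq` is forced by the image (order prime to `p`), so the `n = 1` road of the split branch is closed there.
Unconditional. [cite: Serre1972, Prop. 15 (p. 280) and §1.12] [cite: MazurTateTeitelbaum1986Invent, §II.1] -/
theorem not_unitDerivativeLocus (hp2 : p ≠ 2) (Dq : TateParameterData W p) (hq : ∃ r : ℚ_[p], r ^ p = Dq.q)
    {N : ℕ} (f : CuspForm (Gamma0 N) 2) (ϖ : ℚ)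
    (hint : ‖((ϖ * ratPlusSymbol f 0 : ℚ) : ℚ_[p])‖ ≤ ‖((Dq.q.valuation : ℤ) : ℚ_[p])‖) :
    ‖((ϖ : ℚ) : ℚ_[p]) * LInvariant Dq * (ratPlusSymbol f 0 : ℚ_[p])‖ ≠ (p : ℝ)⁻¹ := by
  have hP : p.Prime := Fact.out
  have h := norm_LInvariant_term_le hp2 Dq hq f ϖ hint
  intro heq
  rw [heq] at h
  have hpos : (0 : ℝ) < (p : ℝ)⁻¹ := inv_pos.mpr (by exact_mod_cast hP.pos)
  have hlt : (p : ℝ)⁻¹ * (p : ℝ)⁻¹ < (p : ℝ)⁻¹ * 1 :=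
    mul_lt_mul_of_pos_left (inv_lt_one_of_one_lt₀ (by exact_mod_cast hP.one_lt)) hpos
  rw [mul_one] at hlt
  exact absurd (lt_of_le_of_lt h hlt) (lt_irrefl _)

/-- **THE SPLIT FLOOR, `[T¹]`.** `E/ℚ` with split multiplicative reduction at an odd prime `p` (Tate datum `Dq`) whose Tate parameter is a
`p`-th power in `ℚ_p` (`hq` — on the corner forced by «`ρ̄_{E,p}` irreducible, not surjective»: image of order prime to `p`, Serre's
Prop. 15, so the Kummer class of `q_E` vanishes), a newform `f` of `E`, its Mazur–Tate–Teitelbaum function `L` at `p` (root `a_p = 1`) and a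
period ratio `ϖ` with `ϖ·[0]⁺_f ∕ ord_p q_E` `p`-integral (`hint`; on the corner `ϖ[0]⁺_f = #Ш_an·∏c∕#tors²` and `c_p = ord_p q_E`). Then,
granted Greenberg–Stevens `[T¹]·log_p γ = 𝓛_p(E)·[0]⁺_f` by name (through g6's `MuAnUnit.norm_coeff_one_C_mul_of_one`),
**`‖[T¹](ϖ·L)‖ ≤ p⁻¹`**: the coefficient of `T¹` is NOT a `p`-adic unit. CONDITIONAL on `greenberg_stevens`; nothing asserted about any curve.
[cite: Kobayashi2006DocMath, Cor. 4.2 (p. 575)] [cite: GreenbergStevens1993, Introduction Thm. (0.3) and Thm. 7.1]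
[cite: MazurTateTeitelbaum1986Invent, §II.1 (𝓛_p = log_p q ∕ ord_p q)] [cite: Serre1972, Prop. 15 (p. 280)] -/
theorem norm_coeff_one_C_mul_le (hp2 : p ≠ 2) [W.IsGloballyMinimal] (hGS : greenberg_stevens W p) (Dq : TateParameterData W p)
    (hq : ∃ r : ℚ_[p], r ^ p = Dq.q)
    {N : ℕ} [NeZero N] {f : CuspForm (Gamma0 N) 2} (hf : IsNewformOf W f)
    {L : PowerSeries ℚ_[p]} (hL : IsMultPAdicLFunctionOf f p 1 L) (ϖ : ℚ)
    (hint : ‖((ϖ * ratPlusSymbol f 0 : ℚ) : ℚ_[p])‖ ≤ ‖((Dq.q.valuation : ℤ) : ℚ_[p])‖) :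
    ‖PowerSeries.coeff 1 (PowerSeries.C ((ϖ : ℚ) : ℚ_[p]) * L)‖ ≤ (p : ℝ)⁻¹ := by
  have hP : p.Prime := Fact.out
  have hp0 : (p : ℝ) ≠ 0 := by exact_mod_cast hP.ne_zero
  rw [MuAnUnit.norm_coeff_one_C_mul_of_one hp2 hGS Dq hf hL]
  calc (p : ℝ) * ‖((ϖ : ℚ) : ℚ_[p]) * LInvariant Dq * (ratPlusSymbol f 0 : ℚ_[p])‖
      ≤ (p : ℝ) * ((p : ℝ)⁻¹ * (p : ℝ)⁻¹) :=
        mul_le_mul_of_nonneg_left (norm_LInvariant_term_le hp2 Dq hq f ϖ hint) (by positivity)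
    _ = (p : ℝ)⁻¹ := by rw [← mul_assoc, mul_inv_cancel₀ hp0, one_mul]

/-- **No certificate below `T²` at a split `p` with `q_E` a `p`-th power.** Same data as `norm_coeff_one_C_mul_le`: every index `n`
at which `ϖ·L` has a `p`-adic UNIT coefficient satisfies `2 ≤ n` — `[T⁰] = 0` is the trivial zero (Mazur–Tate–Teitelbaum) and
`‖[T¹]‖ ≤ p⁻¹ < 1` (§1). So at a split corner twin the μ = 0 certificate of 23047 is never the unit VALUE nor the `[T¹]` coefficient;
a level-`p²` table is the floor. CONDITIONAL on `greenberg_stevens`; nothing asserted about any curve.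
[cite: MazurTateTeitelbaum1986Invent, §I.15 Proposition, case I (p. 21)] [cite: Kobayashi2006DocMath, Cor. 4.2 (p. 575)]
[cite: Serre1972, Prop. 15 (p. 280)] -/
theorem two_le_of_norm_coeff_eq_one (hp2 : p ≠ 2) [W.IsGloballyMinimal] (hGS : greenberg_stevens W p)
    (Dq : TateParameterData W p) (hq : ∃ r : ℚ_[p], r ^ p = Dq.q)
    {N : ℕ} [NeZero N] {f : CuspForm (Gamma0 N) 2} (hf : IsNewformOf W f)
    {L : PowerSeries ℚ_[p]} (hL : IsMultPAdicLFunctionOf f p 1 L) (ϖ : ℚ)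
    (hint : ‖((ϖ * ratPlusSymbol f 0 : ℚ) : ℚ_[p])‖ ≤ ‖((Dq.q.valuation : ℤ) : ℚ_[p])‖)
    {n : ℕ} (hn : ‖PowerSeries.coeff n (PowerSeries.C ((ϖ : ℚ) : ℚ_[p]) * L)‖ = 1) : 2 ≤ n := by
  have hP : p.Prime := Fact.out
  by_contra hlt
  have hn2 : n = 0 ∨ n = 1 := by omega
  rcases hn2 with rfl | rfl
  · -- trivial zero
    rw [MuAnUnit.coeff_zero_C_mul_of_one hL, norm_zero] at hn
    exact zero_ne_one hn
  · have h1 := norm_coeff_one_C_mul_le hp2 hGS Dq hq hf hL ϖ hint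
    rw [hn] at h1
    have : (1 : ℝ) < 1 := lt_of_le_of_lt h1 (inv_lt_one_of_one_lt₀ (by exact_mod_cast hP.one_lt))
    exact lt_irrefl _ this

/-- **The split floor in the binder shape of 23047's clause** (`Theorems.NonSurjCornerTwinMuAnDeep`: allowable root `a` with
`split → a = 1`, `IsMultPAdicLFunctionOf f p a L`, conclusion `∃ n, ‖[Tⁿ](ϖ·L)‖ = 1`): at a curve SPLIT at an odd `p` with Tate
parameter a `p`-th power and `ϖ[0]⁺_f ∕ ord_p q` `p`-integral, every witness `n` of the clause has `2 ≤ n`. For lane B: the twins of the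
split deep pair `J9t-231o115d94` (and of every split corner pair) are certified, if at all, by `MuTable` records of level `n ≥ 2` with
`lam ≥ 2` — never by a unit value, never at `[T¹]`. CONDITIONAL on `greenberg_stevens`; nothing asserted about any curve; 23047 stays OPEN.
[cite: Kobayashi2006DocMath, Cor. 4.2 (p. 575)] [cite: MazurTateTeitelbaum1986Invent, §I.15 Proposition, case I (p. 21)]
[cite: Serre1972, Prop. 15 (p. 280)] -/
theorem two_le_of_norm_coeff_eq_one_of_allowableRoot (hp2 : p ≠ 2) [W.IsGloballyMinimal]
    (hGS : greenberg_stevens W p) (Dq : TateParameterData W p) (hq : ∃ r : ℚ_[p], r ^ p = Dq.q)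
    {N : ℕ} [NeZero N] {f : CuspForm (Gamma0 N) 2} (hf : IsNewformOf W f) (ϖ : ℚ)
    (hint : ‖((ϖ * ratPlusSymbol f 0 : ℚ) : ℚ_[p])‖ ≤ ‖((Dq.q.valuation : ℤ) : ℚ_[p])‖)
    (a : ℚ_[p]) (L : PowerSeries ℚ_[p]) (hsa : W.HasSplitMultiplicativeReductionAtPrime p → a = 1)
    (hL : IsMultPAdicLFunctionOf f p a L)
    {n : ℕ} (hn : ‖PowerSeries.coeff n (PowerSeries.C ((ϖ : ℚ) : ℚ_[p]) * L)‖ = 1) : 2 ≤ n := by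
  have ha : a = 1 := hsa Dq.split
  subst ha
  exact two_le_of_norm_coeff_eq_one hp2 hGS Dq hq hf hL ϖ hint hn

end SplitFloor

end Summit.BirchSwinnertonDyer.BirchSwinnertonDyer.Theorems

end
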